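import Mathlib.AlgebraicGeometry.Morphisms.FinitePresentation
import Mathlib.AlgebraicGeometry.PullbackCarrier
import HarnessLib

/-!
# Spreading out from the generic point: (non-)emptiness of fibres near the generic fibre

Topic: `Literature/AlgebraicGeometry/Limits` (EGA IV₃ §§8–9, "spreading out"). The most basic
instance of the principle "what holds at the generic point of an integral base holds over a
dense open": for a morphism `f : X → Spec B` of finite presentation over a domain `B` and a
constructible subset `Z ⊆ X` (e.g. `Z = X`, or a closed subscheme of finite presentation),

* if the generic fibre meets `Z`, then every fibre over a dense open `D(b)`, `b ≠ 0`, meets `Z`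
  (`exists_basicOpen_subset_image`);
* if the generic fibre misses `Z`, then so does every fibre over some `D(b)`, `b ≠ 0`
  (`exists_basicOpen_disjoint_image`);

both by Chevalley's theorem (Mathlib `Scheme.Hom.isConstructible_image`: the image of a
constructible set under a morphism of finite presentation is constructible; EGA IV₁ 1.8.4,
Stacks 054K) and the elementary fact that **a constructible subset of `Spec B` containing the
generic point contains a non-empty basic open** (`exists_basicOpen_subset_of_isConstructible`;
EGA IV₃ 9.2.3-style / Stacks 0540 in spirit: a constructible set is a finite union of
`D(b) ∖ (D(b₁) ∪ … ∪ D(bₘ))`, and the piece containing the generic point `(0)` has `b ≠ 0` and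
all `bᵢ = 0`). For use at field-valued points `φ : B → k` of the base (the shape in which
"for all fields of characteristic `p ≫ 0`" statements are assembled, cf.
`Literature/AlgebraicGeometry/Resolution/LargeCharacteristic.lean`):
`specMap_mem_basicOpen_iff` (`Spec k → Spec B` lands in `D(b)` iff `φ b ≠ 0`),
`nonempty_pullback_of_subset_range` and `preimage_eq_empty_of_disjoint_image` (the fibre
`X ×_B k` is non-empty, resp. misses `Z`, at such points).

## References

* A. Grothendieck, J. Dieudonné, EGA IV₁ (1964) 1.8.4 (Chevalley), IV₃ (1966) §9.2
  (constructible properties spread from the generic point).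
* The Stacks Project, Tags 054K (Chevalley for schemes), 0540, 00FE.
-/

noncomputable section

universe u

open CategoryTheory CategoryTheory.Limits AlgebraicGeometry TopologicalSpace Topology
  PrimeSpectrum

namespace Literature.AlgebraicGeometry.Limits

section PrimeSpectrum

variable {B : Type u} [CommRing B] [IsDomain B]

/-- The generic point `(0)` of `Spec B` (Mathlib: `⊥ : PrimeSpectrum B` for a domain `B`)
lies in `D(b)` iff `b ≠ 0`. [folklore] -/
@[simp] theorem bot_mem_basicOpen_iff (b : B) :
    (⊥ : PrimeSpectrum B) ∈ basicOpen b ↔ b ≠ 0 := by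
  rw [mem_basicOpen, asIdeal_bot, Ideal.mem_bot]

/-- **A constructible subset of `Spec B`, `B` a domain, which contains the generic point
contains a non-empty basic open `D(b)`, `b ≠ 0`** (a constructible set is a finite union of
sets `D(b) ∖ ⋃ⱼ D(bⱼ)`; the one containing `(0)` has `b ≠ 0` and all `bⱼ = 0`). [folklore] -/
theorem exists_basicOpen_subset_of_isConstructible {s : Set (PrimeSpectrum B)}
    (hs : IsConstructible s) (h0 : (⊥ : PrimeSpectrum B) ∈ s) :
    ∃ b : B, b ≠ 0 ∧ (basicOpen b : Set (PrimeSpectrum B)) ⊆ s := by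
  revert h0
  refine IsConstructible.induction_of_isTopologicalBasis
    (P := fun s _ => (⊥ : PrimeSpectrum B) ∈ s →
      ∃ b : B, b ≠ 0 ∧ (basicOpen b : Set (PrimeSpectrum B)) ⊆ s)
    (fun b : B => (basicOpen b : Set (PrimeSpectrum B))) isTopologicalBasis_basic_opens
    (fun b => isCompact_basicOpen b) ?_ ?_ s hs
  · -- `s = D(b) ∖ ⋃_{j ∈ t} D(j)` containing `(0)`: `b ≠ 0` and all `j = 0`
    intro b t _ hmem
    obtain ⟨hb, hnot⟩ := hmem
    refine ⟨b, (bot_mem_basicOpen_iff b).mp hb, fun x hx => ⟨hx, ?_⟩⟩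
    simp only [Set.mem_iUnion, not_exists] at hnot ⊢
    intro j hj hxj
    have hj0 : j = 0 := by
      by_contra h
      exact hnot j hj ((bot_mem_basicOpen_iff j).mpr h)
    subst hj0
    simp at hxj
  · -- unions
    intro s _ t _ ihs iht hmem
    rcases hmem with h | h
    · obtain ⟨b, hb, hbs⟩ := ihs h
      exact ⟨b, hb, hbs.trans Set.subset_union_left⟩
    · obtain ⟨b, hb, hbt⟩ := iht h
      exact ⟨b, hb, hbt.trans Set.subset_union_right⟩

/-- Dually: a constructible subset of `Spec B` missing the generic point misses a non-empty
basic open. [folklore] -/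
theorem exists_basicOpen_disjoint_of_isConstructible {s : Set (PrimeSpectrum B)}
    (hs : IsConstructible s) (h0 : (⊥ : PrimeSpectrum B) ∉ s) :
    ∃ b : B, b ≠ 0 ∧ Disjoint (basicOpen b : Set (PrimeSpectrum B)) s := by
  obtain ⟨b, hb, hbs⟩ := exists_basicOpen_subset_of_isConstructible hs.compl h0
  exact ⟨b, hb, Set.disjoint_left.mpr fun x hx hxs => hbs hx hxs⟩

omit [IsDomain B] in
/-- A field-valued point `φ : B → k` of `Spec B` lands in `D(b)` iff `φ b ≠ 0`. [folklore] -/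
theorem specMap_mem_basicOpen_iff {k : Type u} [Field k] (φ : B →+* k) (b : B)
    (x : Spec (CommRingCat.of k)) :
    (Spec.map (CommRingCat.ofHom φ)) x ∈ (basicOpen b : Set (PrimeSpectrum B)) ↔ φ b ≠ 0 := by
  have hx : x.asIdeal = ⊥ := Ideal.eq_bot_of_prime x.asIdeal
  change PrimeSpectrum.comap φ x ∈ basicOpen b ↔ _
  rw [mem_basicOpen, comap_asIdeal, Ideal.mem_comap, hx, Ideal.mem_bot]

end PrimeSpectrum

section Scheme

variable {B : Type u} [CommRing B] [IsDomain B] {X : Scheme.{u}}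

/-- **Non-empty generic fibre ⇒ non-empty fibres over a dense open** (Chevalley): if
`f : X → Spec B` is of finite presentation (locally of finite presentation and quasi-compact),
`Z ⊆ X` is constructible and the generic point of `Spec B` lies in `f(Z)`, then
`D(b) ⊆ f(Z)` for some `b ≠ 0`. [folklore] -/
theorem exists_basicOpen_subset_image (f : X ⟶ Spec (CommRingCat.of B))
    [LocallyOfFinitePresentation f] [QuasiCompact f] {Z : Set X} (hZ : IsConstructible Z)
    (h0 : (⊥ : PrimeSpectrum B) ∈ f '' Z) :
    ∃ b : B, b ≠ 0 ∧ (basicOpen b : Set (PrimeSpectrum B)) ⊆ f '' Z :=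
  exists_basicOpen_subset_of_isConstructible (f.isConstructible_image hZ) h0

/-- In particular (`Z = X`): if the generic point is in the image then `D(b) ⊆ f(X)` for some
`b ≠ 0`. [folklore] -/
theorem exists_basicOpen_subset_range (f : X ⟶ Spec (CommRingCat.of B))
    [LocallyOfFinitePresentation f] [QuasiCompact f] (h0 : (⊥ : PrimeSpectrum B) ∈ Set.range f) :
    ∃ b : B, b ≠ 0 ∧ (basicOpen b : Set (PrimeSpectrum B)) ⊆ Set.range f := by
  rw [← Set.image_univ] at h0 ⊢
  exact exists_basicOpen_subset_image f IsConstructible.univ h0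

/-- **Empty generic fibre ⇒ empty fibres over a dense open** (Chevalley): if the generic point
is not in `f(Z)` then `D(b) ∩ f(Z) = ∅` for some `b ≠ 0`. [folklore] -/
theorem exists_basicOpen_disjoint_image (f : X ⟶ Spec (CommRingCat.of B))
    [LocallyOfFinitePresentation f] [QuasiCompact f] {Z : Set X} (hZ : IsConstructible Z)
    (h0 : (⊥ : PrimeSpectrum B) ∉ f '' Z) :
    ∃ b : B, b ≠ 0 ∧ Disjoint (basicOpen b : Set (PrimeSpectrum B)) (f '' Z) :=
  exists_basicOpen_disjoint_of_isConstructible (f.isConstructible_image hZ) h0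

omit [IsDomain B] in
/-- At a field-valued point `φ : B → k` with `φ b ≠ 0`, `D(b) ⊆ f(X)` makes the fibre
`X ×_{Spec B} Spec k` non-empty. [folklore] -/
theorem nonempty_pullback_of_subset_range (f : X ⟶ Spec (CommRingCat.of B)) {b : B}
    (hb : (basicOpen b : Set (PrimeSpectrum B)) ⊆ Set.range f) {k : Type u} [Field k]
    (φ : B →+* k) (hφ : φ b ≠ 0) :
    Nonempty ↑(pullback f (Spec.map (CommRingCat.ofHom φ))) := by
  let y : Spec (CommRingCat.of k) := ⟨⊥, Ideal.isPrime_bot⟩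
  obtain ⟨x, hx⟩ := hb ((specMap_mem_basicOpen_iff φ b y).mpr hφ)
  obtain ⟨z, -, -⟩ := Scheme.Pullback.exists_preimage_pullback x y hx
  exact ⟨z⟩

omit [IsDomain B] in
/-- At a field-valued point `φ : B → k` with `φ b ≠ 0`, `D(b) ∩ f(Z) = ∅` makes the fibre
`X ×_{Spec B} Spec k` miss `Z`. [folklore] -/
theorem preimage_eq_empty_of_disjoint_image (f : X ⟶ Spec (CommRingCat.of B)) {Z : Set X}
    {b : B} (hb : Disjoint (basicOpen b : Set (PrimeSpectrum B)) (f '' Z)) {k : Type u}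
    [Field k] (φ : B →+* k) (hφ : φ b ≠ 0) :
    (pullback.fst f (Spec.map (CommRingCat.ofHom φ))) ⁻¹' Z = ∅ := by
  ext z
  simp only [Set.mem_preimage, Set.mem_empty_iff_false, iff_false]
  intro hz
  have hmem : f (pullback.fst f (Spec.map (CommRingCat.ofHom φ)) z) ∈
      (basicOpen b : Set (PrimeSpectrum B)) := by
    have e : f (pullback.fst f (Spec.map (CommRingCat.ofHom φ)) z) =
        Spec.map (CommRingCat.ofHom φ) (pullback.snd f (Spec.map (CommRingCat.ofHom φ)) z) := by
      rw [← Scheme.Hom.comp_apply, ← Scheme.Hom.comp_apply, pullback.condition]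
    rw [e]
    exact (specMap_mem_basicOpen_iff φ b _).mpr hφ
  exact Set.disjoint_left.mp hb hmem ⟨_, hz, rfl⟩

end Scheme

end Literature.AlgebraicGeometry.Limits

end
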